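import Literature.MathematicalPhysics.QuantumFieldTheory.Balaban1983to89.B9PerturbationMajorantAlgebra

/-!
# `Balaban1983to89.B9PerturbationMajorantLetters` — [B9] (3.131) p. 422 AS BLOCK-MAJORANT ALGEBRA: the six propagator letters G′RD\*, DRG′, RG′, G′R,
# RG′D\*, DG′R («Theorem 3.1 and the inequality (3.49)», p. 421) and the FOUR SPLIT-LETTER MAJORANTS of Δ′_π — T_a = BG′RD\*, T_b = RG′B† − RG′D\*BG′RD\*,
# T_a′ = DRG′B†, T_b′ = BG′R − DRG′D\*BG′R — between the state classes, from the schemas `Thm31GpMaj`, `Proj349Maj`, `CurrentMaj`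

T. Bałaban, *Propagators for lattice gauge theories in a background field*, Commun. Math. Phys. **99** (1985) 389–434 [`Balaban1985BackgroundPropagators`,
"B9"]; [4] = T. Bałaban, *Propagators and renormalization transformations for lattice gauge theories. II*, Commun. Math. Phys. **96** (1984) 223–250
[`Balaban1984PropagatorsII`].  statement-level skeleton of published theorems with citation tags; proofs where landed; nothing here is a claim about
the Yang–Mills mass gap.  Sequel of `B9PerturbationMajorantAlgebra` (the 𝔠^{(s)} calculus and the three printed-shape schemas); see its header for the
printed loci (Thm 3.1 (3.42) p. 397, the p. 398 transfer remark, (3.49) p. 399, p. 421, (3.131) p. 422).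
WHAT IS PROVED (0 sorry; R := ϱ·(I − P) throughout, ϱ ≧ 0 the model's scalar; σ = the row-sum margin of [4] (2.61), αδ = the transfer loss of (2.60)).
* §3 ★ the six letters at the common constant `constA ϱ B₀ C_P c L = ϱB₀(1 + L²C_Pc)` and rate r − σ − αδ: `maj_GpRDvs` (𝒫 = G′RD\* : 𝔠^{(0)} → 𝔠_W^{(−1)} —
  the derivative D\* absorbed by G′ through (3.42)₃ and, across R, by (3.49)₃), `maj_DvRGp` (𝒫† = DRG′ : 𝔠_W^{(0)} → 𝔠^{(−1)}), `maj_RGp` (𝒬 = RG′ :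
  𝔠_W^{(0)} → 𝔠_W^{(−2)}), `maj_GpR` (𝒬† = G′R), `maj_RGpDvs` (𝒮 = RG′D\* : 𝔠^{(0)} → 𝔠_W^{(−1)}), `maj_DvGpR` (𝒮† = DG′R : 𝔠_W^{(0)} → 𝔠^{(−1)}).
* §4 ★★ `maj_taL` (T_a = B·𝒫 : `cNorm … 2 → cNorm … 0`), `maj_tbL` (T_b = 𝒬·B† − 𝒮·B·𝒫 : `cNorm … 2 → cNorm_W … 1`), `maj_taR` (T_a′ = 𝒫†·B† : `cNorm … 2 →
  cNorm … 0`), `maj_tbR` (T_b′ = B·𝒬† − 𝒫†·B†·𝒮† : `cNormR_W … 0 → cNormR … 1`) — EXACTLY the classes of the `ta ∕ tb` fields of dag-n06-l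
  `B9Thm312WholeStepFrom3131.Letters3131` ∕ `B9Thm312WholeRightStepFrom3131.Letters3131R` — with the block majorant `(Σ|wᵢ|)·const3131·t_B·e^{−δ_T d}` for the words
  with scalar weights `wᵢ` (as they occur at the pinned models), `const3131 = c·L⁵·A·(1 + A·c)`, for every δ_T ≧ 0 with δ_T + 2σ + 3αδ ≦ r ≦ min(δ₀, δ_P, δ_B) (at most two compositions and three transfers per word; print's
  t = O(1)·Mα₀ is `const3131·t_B` with t_B = O(1)·Mα₀ the current size of (3.117) ∕ (3.36)).
The reading at node00-def-Y's pinned coordinate models (the four Δ′_π majorant hypotheses of the N06 certificate, dag-n06-d edition 19) is the sequel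
`B9PerturbationMajorantsAtLetters`.
HONEST SCOPE.  Kernel-checked bookkeeping over FREE finite carriers with block maps; Theorem 3.1, (3.49), (3.117)∕(3.36) enter as HYPOTHESIS SCHEMAS (nothing of
[B9] or [4] asserted); the Δ⁽²⁾ letters of (3.135)–(3.137) are NOT treated (Δ⁽²⁾ is a parameter of def-Y's record; dag-n06-l STEP-SCHEMA-FORMS-MEMO U1);
count-neutral; N06 NOT discharged; one finite lattice at a time — nothing continuum ∕ ℝ⁴ ∕ OS ∕ mass gap ∕ Clay.  Cell `pub-ymgap` (HUMAN RULING D-0062), Track A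
node N06 [B9], bundle F7 rows 20–21, seat `pub-ymgap-dag-n06-l` (g14), 2026-08-27.  NEW file; nothing landed is modified.
-/

namespace Literature.MathematicalPhysics.QuantumFieldTheory.Balaban1983to89.B9PerturbationMajorantLetters

open Literature.MathematicalPhysics.QuantumFieldTheory.Balaban1983to89
open Finset B6RandomWalk B6RandomWalkHom B9Thm34Ext B11SectG B9SectDSup B9Thm312Whole B9Thm312WholeClasses
open B9Thm37AllNorms B9RWSums343to347Whole B9RWSums346Schur B9Ineq347 B9PerturbationMajorantAlgebra

noncomputable section

variable {g : B9.Geometry} {XS XB : Type} [Fintype XS] [Fintype XB] [Fintype g.Site]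
variable {R₀ : ℝ} {H₀ : Prop}

/-! ## §3 The six propagator letters of (3.131): «Theorem 3.1 and the inequality (3.49)» between the state classes -/

section Letters

variable {blkW : XS → g.Site} {blk : XB → g.Site} {Gp P R : Module.End ℝ (XS → ℝ)} {Dv : (XS → ℝ) →ₗ[ℝ] (XB → ℝ)}
  {Dvs : (XB → ℝ) →ₗ[ℝ] (XS → ℝ)} {B₀ CP r ϱ σ c : ℝ} {dF : ℕ} {δ α L₀ : ℝ}

/-- ★ **THE LETTER 𝒫 = G′RD\* : 𝔠^{(0)} → 𝔠_W^{(−1)}** (order Lʲη: the derivative D\* is absorbed by G′ through (3.42)₃ and, across R = ϱ(I − P), by (3.49)₃):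
G′RD\* = ϱ(G′D\* − G′(PD\*)); majorant `constA·e^{−(r−σ−αδ)d}`. [cite: Balaban1985BackgroundPropagators, p.421, (3.42) p.397, (3.49) p.399; Balaban1984PropagatorsII, (2.54)+(2.61), (2.60) p.234] -/
theorem maj_GpRDvs (hG : GeoOK g) (hF : Facts347 g R₀ H₀ dF δ α L₀) (hrow : RowSum (toB6 g R₀ H₀) σ c)
    (hGp : HasMaj (cNormR R₀ H₀ blkW hG.lenle 0) (cNormR R₀ H₀ blkW hG.lenle (-2)) Gp (fun a b => B₀ * Real.exp (-(r * g.dist a b))))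
    (hGpDvs : HasMaj (cNormR R₀ H₀ blk hG.lenle 0) (cNormR R₀ H₀ blkW hG.lenle (-1)) (Gp ∘ₗ Dvs) (fun a b => B₀ * Real.exp (-(r * g.dist a b))))
    (hPDvs : HasMaj (cNormR R₀ H₀ blk hG.lenle 0) (cNormR R₀ H₀ blkW hG.lenle 1) (P ∘ₗ Dvs) (fun a b => CP * Real.exp (-(r * g.dist a b))))
    (hR : R = ϱ • (LinearMap.id - P)) (hϱ : 0 ≤ ϱ) (hB₀ : 0 ≤ B₀) (hCP : 0 ≤ CP) (hc : 0 ≤ c) (hσ : 0 ≤ σ) (hτ : 0 ≤ α * δ)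
    (hbud : 0 ≤ r - σ - α * δ) :
    HasMaj (cNormR R₀ H₀ blk hG.lenle 0) (cNormR R₀ H₀ blkW hG.lenle (-1)) (Gp ∘ₗ R ∘ₗ Dvs)
      (fun a b => constA ϱ B₀ CP c g.L * Real.exp (-((r - σ - α * δ) * g.dist a b))) := by
  -- G′ shifted by +1: 𝔠_W^{(1)} → 𝔠_W^{(−1)}, constant B₀L, rate r − αδ
  have hGp' := hasMaj_shift hG hF (1 : ℝ) (by norm_num) hB₀ hGp
  rw [rpow_abs_eq_pow g.L 1 1 (by norm_num), pow_one, show (0 : ℝ) + 1 = 1 by norm_num,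
    show (-2 : ℝ) + 1 = -1 by norm_num] at hGp'
  -- G′∘(PD\*): 𝔠^{(0)} → 𝔠_W^{(−1)}, constant B₀L·C_P·c, rate r − σ − αδ
  have h2 := hasMaj_comp_cNormR hG hrow (mul_nonneg hB₀ (le_trans zero_le_one hF.one_le_L)) hCP hbud
    (by linarith) (by linarith) hGp' hPDvs
  -- G′D\* weakened to the same rate
  have h1 := hasMaj_weaken hG hB₀ le_rfl (show r - σ - α * δ ≤ r by linarith) hGpDvs
  have hsm := (hasMaj_smul_cNormR (hasMaj_sub_exp h1 h2) ϱ).congr (T' := Gp ∘ₗ R ∘ₗ Dvs) fun μ => by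
    simp only [hR, LinearMap.smul_apply, LinearMap.sub_apply, LinearMap.comp_apply, LinearMap.id_apply, map_smul, map_sub]
  refine hsm.mono fun a b => ?_
  show |ϱ| * ((B₀ + B₀ * g.L * CP * c) * Real.exp (-((r - σ - α * δ) * g.dist a b))) ≤
    constA ϱ B₀ CP c g.L * Real.exp (-((r - σ - α * δ) * g.dist a b))
  rw [abs_of_nonneg hϱ, ← mul_assoc]
  refine mul_le_mul_of_nonneg_right ?_ (Real.exp_nonneg _)
  calc _ = ϱ * B₀ * (1 + g.L ^ 1 * CP * c) := by ring
    _ ≤ constA ϱ B₀ CP c g.L := le_constA hϱ hB₀ hCP hc hF.one_le_L (by norm_num)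

/-- ★ **THE LETTER 𝒫† = DRG′ : 𝔠_W^{(0)} → 𝔠^{(−1)}**: DRG′ = ϱ(DG′ − (DP)G′) ((3.42)₂, (3.49)₂); majorant `constA·e^{−(r−σ−αδ)d}`.
[cite: Balaban1985BackgroundPropagators, p.421, (3.42) p.397, (3.49) p.399; Balaban1984PropagatorsII, (2.54)+(2.61), (2.60) p.234] -/
theorem maj_DvRGp (hG : GeoOK g) (hF : Facts347 g R₀ H₀ dF δ α L₀) (hrow : RowSum (toB6 g R₀ H₀) σ c)
    (hGp : HasMaj (cNormR R₀ H₀ blkW hG.lenle 0) (cNormR R₀ H₀ blkW hG.lenle (-2)) Gp (fun a b => B₀ * Real.exp (-(r * g.dist a b))))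
    (hDvGp : HasMaj (cNormR R₀ H₀ blkW hG.lenle 0) (cNormR R₀ H₀ blk hG.lenle (-1)) (Dv ∘ₗ Gp) (fun a b => B₀ * Real.exp (-(r * g.dist a b))))
    (hDvP : HasMaj (cNormR R₀ H₀ blkW hG.lenle 0) (cNormR R₀ H₀ blk hG.lenle 1) (Dv ∘ₗ P) (fun a b => CP * Real.exp (-(r * g.dist a b))))
    (hR : R = ϱ • (LinearMap.id - P)) (hϱ : 0 ≤ ϱ) (hB₀ : 0 ≤ B₀) (hCP : 0 ≤ CP) (hc : 0 ≤ c) (hσ : 0 ≤ σ) (hτ : 0 ≤ α * δ)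
    (hbud : 0 ≤ r - σ - α * δ) :
    HasMaj (cNormR R₀ H₀ blkW hG.lenle 0) (cNormR R₀ H₀ blk hG.lenle (-1)) (Dv ∘ₗ R ∘ₗ Gp)
      (fun a b => constA ϱ B₀ CP c g.L * Real.exp (-((r - σ - α * δ) * g.dist a b))) := by
  -- DP shifted by −2: 𝔠_W^{(−2)} → 𝔠^{(−1)}, constant C_P L², rate r − αδ
  have hDvP' := hasMaj_shift hG hF (-2 : ℝ) (by norm_num) hCP hDvP
  rw [rpow_abs_eq_pow g.L (-2) 2 (by norm_num), show (0 : ℝ) + -2 = -2 by norm_num, show (1 : ℝ) + -2 = -1 by norm_num] at hDvP'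
  have h2 := hasMaj_comp_cNormR hG hrow (mul_nonneg hCP (pow_nonneg (le_trans zero_le_one hF.one_le_L) 2)) hB₀ hbud
    (by linarith) (by linarith) hDvP' hGp
  have h1 := hasMaj_weaken hG hB₀ le_rfl (show r - σ - α * δ ≤ r by linarith) hDvGp
  have hsm := (hasMaj_smul_cNormR (hasMaj_sub_exp h1 h2) ϱ).congr (T' := Dv ∘ₗ R ∘ₗ Gp) fun μ => by
    simp only [hR, LinearMap.smul_apply, LinearMap.sub_apply, LinearMap.comp_apply, LinearMap.id_apply, map_smul, map_sub]
  refine hsm.mono fun a b => ?_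
  show |ϱ| * ((B₀ + CP * g.L ^ 2 * B₀ * c) * Real.exp (-((r - σ - α * δ) * g.dist a b))) ≤
    constA ϱ B₀ CP c g.L * Real.exp (-((r - σ - α * δ) * g.dist a b))
  rw [abs_of_nonneg hϱ, ← mul_assoc]
  refine mul_le_mul_of_nonneg_right ?_ (Real.exp_nonneg _)
  calc _ = ϱ * B₀ * (1 + g.L ^ 2 * CP * c) := by ring
    _ ≤ constA ϱ B₀ CP c g.L := le_constA hϱ hB₀ hCP hc hF.one_le_L le_rfl

/-- ★ **THE LETTER 𝒬 = RG′ : 𝔠_W^{(0)} → 𝔠_W^{(−2)}**: RG′ = ϱ(G′ − PG′) ((3.42)₁, (3.49)₁); majorant `constA·e^{−(r−σ−αδ)d}`.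
[cite: Balaban1985BackgroundPropagators, p.421, (3.42) p.397, (3.49) p.399; Balaban1984PropagatorsII, (2.54)+(2.61), (2.60) p.234] -/
theorem maj_RGp (hG : GeoOK g) (hF : Facts347 g R₀ H₀ dF δ α L₀) (hrow : RowSum (toB6 g R₀ H₀) σ c)
    (hGp : HasMaj (cNormR R₀ H₀ blkW hG.lenle 0) (cNormR R₀ H₀ blkW hG.lenle (-2)) Gp (fun a b => B₀ * Real.exp (-(r * g.dist a b))))
    (hP : HasMaj (cNormR R₀ H₀ blkW hG.lenle 0) (cNormR R₀ H₀ blkW hG.lenle 0) P (fun a b => CP * Real.exp (-(r * g.dist a b))))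
    (hR : R = ϱ • (LinearMap.id - P)) (hϱ : 0 ≤ ϱ) (hB₀ : 0 ≤ B₀) (hCP : 0 ≤ CP) (hc : 0 ≤ c) (hσ : 0 ≤ σ) (hτ : 0 ≤ α * δ)
    (hbud : 0 ≤ r - σ - α * δ) :
    HasMaj (cNormR R₀ H₀ blkW hG.lenle 0) (cNormR R₀ H₀ blkW hG.lenle (-2)) (R ∘ₗ Gp)
      (fun a b => constA ϱ B₀ CP c g.L * Real.exp (-((r - σ - α * δ) * g.dist a b))) := by
  -- P shifted by −2: 𝔠_W^{(−2)} → 𝔠_W^{(−2)}, constant C_P L², rate r − αδ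
  have hP' := hasMaj_shift hG hF (-2 : ℝ) (by norm_num) hCP hP
  rw [rpow_abs_eq_pow g.L (-2) 2 (by norm_num), show (0 : ℝ) + -2 = -2 by norm_num] at hP'
  have h2 := hasMaj_comp_cNormR hG hrow (mul_nonneg hCP (pow_nonneg (le_trans zero_le_one hF.one_le_L) 2)) hB₀ hbud
    (by linarith) (by linarith) hP' hGp
  -- the identity part: G′ itself, weakened
  have h1 := hasMaj_weaken hG hB₀ le_rfl (show r - σ - α * δ ≤ r by linarith) hGp
  have hsm := (hasMaj_smul_cNormR (hasMaj_sub_exp h1 h2) ϱ).congr (T' := R ∘ₗ Gp) fun μ => by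
    simp only [hR, LinearMap.smul_apply, LinearMap.sub_apply, LinearMap.comp_apply, LinearMap.id_apply]
  refine hsm.mono fun a b => ?_
  show |ϱ| * ((B₀ + CP * g.L ^ 2 * B₀ * c) * Real.exp (-((r - σ - α * δ) * g.dist a b))) ≤
    constA ϱ B₀ CP c g.L * Real.exp (-((r - σ - α * δ) * g.dist a b))
  rw [abs_of_nonneg hϱ, ← mul_assoc]
  refine mul_le_mul_of_nonneg_right ?_ (Real.exp_nonneg _)
  calc _ = ϱ * B₀ * (1 + g.L ^ 2 * CP * c) := by ring
    _ ≤ constA ϱ B₀ CP c g.L := le_constA hϱ hB₀ hCP hc hF.one_le_L le_rfl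

/-- ★ **THE LETTER 𝒬† = G′R : 𝔠_W^{(0)} → 𝔠_W^{(−2)}**: G′R = ϱ(G′ − G′P); majorant `constA·e^{−(r−σ−αδ)d}` (no transfer needed; rate weakened to the common one).
[cite: Balaban1985BackgroundPropagators, p.421, (3.42) p.397, (3.49) p.399; Balaban1984PropagatorsII, (2.54)+(2.61) p.234] -/
theorem maj_GpR (hG : GeoOK g) (hF : Facts347 g R₀ H₀ dF δ α L₀) (hrow : RowSum (toB6 g R₀ H₀) σ c)
    (hGp : HasMaj (cNormR R₀ H₀ blkW hG.lenle 0) (cNormR R₀ H₀ blkW hG.lenle (-2)) Gp (fun a b => B₀ * Real.exp (-(r * g.dist a b))))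
    (hP : HasMaj (cNormR R₀ H₀ blkW hG.lenle 0) (cNormR R₀ H₀ blkW hG.lenle 0) P (fun a b => CP * Real.exp (-(r * g.dist a b))))
    (hR : R = ϱ • (LinearMap.id - P)) (hϱ : 0 ≤ ϱ) (hB₀ : 0 ≤ B₀) (hCP : 0 ≤ CP) (hc : 0 ≤ c) (hσ : 0 ≤ σ) (hτ : 0 ≤ α * δ)
    (hbud : 0 ≤ r - σ - α * δ) :
    HasMaj (cNormR R₀ H₀ blkW hG.lenle 0) (cNormR R₀ H₀ blkW hG.lenle (-2)) (Gp ∘ₗ R)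
      (fun a b => constA ϱ B₀ CP c g.L * Real.exp (-((r - σ - α * δ) * g.dist a b))) := by
  have h2 := hasMaj_comp_cNormR hG hrow hB₀ hCP hbud (by linarith) (by linarith) hGp hP
  have h1 := hasMaj_weaken hG hB₀ le_rfl (show r - σ - α * δ ≤ r by linarith) hGp
  have hsm := (hasMaj_smul_cNormR (hasMaj_sub_exp h1 h2) ϱ).congr (T' := Gp ∘ₗ R) fun μ => by
    simp only [hR, LinearMap.smul_apply, LinearMap.sub_apply, LinearMap.comp_apply, LinearMap.id_apply, map_smul, map_sub]
  refine hsm.mono fun a b => ?_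
  show |ϱ| * ((B₀ + B₀ * CP * c) * Real.exp (-((r - σ - α * δ) * g.dist a b))) ≤
    constA ϱ B₀ CP c g.L * Real.exp (-((r - σ - α * δ) * g.dist a b))
  rw [abs_of_nonneg hϱ, ← mul_assoc]
  refine mul_le_mul_of_nonneg_right ?_ (Real.exp_nonneg _)
  calc _ = ϱ * B₀ * (1 + g.L ^ 0 * CP * c) := by ring
    _ ≤ constA ϱ B₀ CP c g.L := le_constA hϱ hB₀ hCP hc hF.one_le_L (by norm_num)

/-- ★ **THE LETTER 𝒮 = RG′D\* : 𝔠^{(0)} → 𝔠_W^{(−1)}**: RG′D\* = ϱ(G′D\* − P(G′D\*)) ((3.42)₃, (3.49)₁); majorant `constA·e^{−(r−σ−αδ)d}`.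
[cite: Balaban1985BackgroundPropagators, p.421, (3.42) p.397, (3.49) p.399; Balaban1984PropagatorsII, (2.54)+(2.61), (2.60) p.234] -/
theorem maj_RGpDvs (hG : GeoOK g) (hF : Facts347 g R₀ H₀ dF δ α L₀) (hrow : RowSum (toB6 g R₀ H₀) σ c)
    (hGpDvs : HasMaj (cNormR R₀ H₀ blk hG.lenle 0) (cNormR R₀ H₀ blkW hG.lenle (-1)) (Gp ∘ₗ Dvs) (fun a b => B₀ * Real.exp (-(r * g.dist a b))))
    (hP : HasMaj (cNormR R₀ H₀ blkW hG.lenle 0) (cNormR R₀ H₀ blkW hG.lenle 0) P (fun a b => CP * Real.exp (-(r * g.dist a b))))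
    (hR : R = ϱ • (LinearMap.id - P)) (hϱ : 0 ≤ ϱ) (hB₀ : 0 ≤ B₀) (hCP : 0 ≤ CP) (hc : 0 ≤ c) (hσ : 0 ≤ σ) (hτ : 0 ≤ α * δ)
    (hbud : 0 ≤ r - σ - α * δ) :
    HasMaj (cNormR R₀ H₀ blk hG.lenle 0) (cNormR R₀ H₀ blkW hG.lenle (-1)) (R ∘ₗ Gp ∘ₗ Dvs)
      (fun a b => constA ϱ B₀ CP c g.L * Real.exp (-((r - σ - α * δ) * g.dist a b))) := by
  -- P shifted by −1: 𝔠_W^{(−1)} → 𝔠_W^{(−1)}, constant C_P L, rate r − αδ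
  have hP' := hasMaj_shift hG hF (-1 : ℝ) (by norm_num) hCP hP
  rw [rpow_abs_eq_pow g.L (-1) 1 (by norm_num), pow_one, show (0 : ℝ) + -1 = -1 by norm_num] at hP'
  have h2 := hasMaj_comp_cNormR hG hrow (mul_nonneg hCP (le_trans zero_le_one hF.one_le_L)) hB₀ hbud
    (by linarith) (by linarith) hP' hGpDvs
  have h1 := hasMaj_weaken hG hB₀ le_rfl (show r - σ - α * δ ≤ r by linarith) hGpDvs
  have hsm := (hasMaj_smul_cNormR (hasMaj_sub_exp h1 h2) ϱ).congr (T' := R ∘ₗ Gp ∘ₗ Dvs) fun μ => by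
    simp only [hR, LinearMap.smul_apply, LinearMap.sub_apply, LinearMap.comp_apply, LinearMap.id_apply]
  refine hsm.mono fun a b => ?_
  show |ϱ| * ((B₀ + CP * g.L * B₀ * c) * Real.exp (-((r - σ - α * δ) * g.dist a b))) ≤
    constA ϱ B₀ CP c g.L * Real.exp (-((r - σ - α * δ) * g.dist a b))
  rw [abs_of_nonneg hϱ, ← mul_assoc]
  refine mul_le_mul_of_nonneg_right ?_ (Real.exp_nonneg _)
  calc _ = ϱ * B₀ * (1 + g.L ^ 1 * CP * c) := by ring
    _ ≤ constA ϱ B₀ CP c g.L := le_constA hϱ hB₀ hCP hc hF.one_le_L (by norm_num)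

/-- ★ **THE LETTER 𝒮† = DG′R : 𝔠_W^{(0)} → 𝔠^{(−1)}**: DG′R = ϱ(DG′ − (DG′)P) ((3.42)₂, (3.49)₁); majorant `constA·e^{−(r−σ−αδ)d}`.
[cite: Balaban1985BackgroundPropagators, p.421, (3.42) p.397, (3.49) p.399; Balaban1984PropagatorsII, (2.54)+(2.61) p.234] -/
theorem maj_DvGpR (hG : GeoOK g) (hF : Facts347 g R₀ H₀ dF δ α L₀) (hrow : RowSum (toB6 g R₀ H₀) σ c)
    (hDvGp : HasMaj (cNormR R₀ H₀ blkW hG.lenle 0) (cNormR R₀ H₀ blk hG.lenle (-1)) (Dv ∘ₗ Gp) (fun a b => B₀ * Real.exp (-(r * g.dist a b))))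
    (hP : HasMaj (cNormR R₀ H₀ blkW hG.lenle 0) (cNormR R₀ H₀ blkW hG.lenle 0) P (fun a b => CP * Real.exp (-(r * g.dist a b))))
    (hR : R = ϱ • (LinearMap.id - P)) (hϱ : 0 ≤ ϱ) (hB₀ : 0 ≤ B₀) (hCP : 0 ≤ CP) (hc : 0 ≤ c) (hσ : 0 ≤ σ) (hτ : 0 ≤ α * δ)
    (hbud : 0 ≤ r - σ - α * δ) :
    HasMaj (cNormR R₀ H₀ blkW hG.lenle 0) (cNormR R₀ H₀ blk hG.lenle (-1)) (Dv ∘ₗ Gp ∘ₗ R)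
      (fun a b => constA ϱ B₀ CP c g.L * Real.exp (-((r - σ - α * δ) * g.dist a b))) := by
  have h2 := hasMaj_comp_cNormR hG hrow hB₀ hCP hbud (by linarith) (by linarith) hDvGp hP
  have h1 := hasMaj_weaken hG hB₀ le_rfl (show r - σ - α * δ ≤ r by linarith) hDvGp
  have hsm := (hasMaj_smul_cNormR (hasMaj_sub_exp h1 h2) ϱ).congr (T' := Dv ∘ₗ Gp ∘ₗ R) fun μ => by
    simp only [hR, LinearMap.smul_apply, LinearMap.sub_apply, LinearMap.comp_apply, LinearMap.id_apply, map_smul, map_sub]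
  refine hsm.mono fun a b => ?_
  show |ϱ| * ((B₀ + B₀ * CP * c) * Real.exp (-((r - σ - α * δ) * g.dist a b))) ≤
    constA ϱ B₀ CP c g.L * Real.exp (-((r - σ - α * δ) * g.dist a b))
  rw [abs_of_nonneg hϱ, ← mul_assoc]
  refine mul_le_mul_of_nonneg_right ?_ (Real.exp_nonneg _)
  calc _ = ϱ * B₀ * (1 + g.L ^ 0 * CP * c) := by ring
    _ ≤ constA ϱ B₀ CP c g.L := le_constA hϱ hB₀ hCP hc hF.one_le_L (by norm_num)

end Letters

/-! ## §4 The four split-letter majorants of Δ′_π: T_a = B𝒫, T_b = 𝒬B† − 𝒮B𝒫, T_a′ = 𝒫†B†, T_b′ = B𝒬† − 𝒫†B†𝒮† -/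

/-- the common constant of the four T-letter majorants (per unit of the current size t_B): `c·L⁵·A·(1 + A·c)`, A = `constA`.
[cite: Balaban1985BackgroundPropagators, (3.131) p.422 («O(1)Mα₀»), bookkeeping] -/
def const3131 (ϱ B₀ CP c L : ℝ) : ℝ := c * L ^ 5 * constA ϱ B₀ CP c L * (1 + constA ϱ B₀ CP c L * c)

/-- `0 ≦ const3131`. [cite: Balaban1985BackgroundPropagators, (3.131) p.422 (bookkeeping)] -/
theorem const3131_nonneg {ϱ B₀ CP c L : ℝ} (hϱ : 0 ≤ ϱ) (hB₀ : 0 ≤ B₀) (hCP : 0 ≤ CP) (hc : 0 ≤ c) (hL : 1 ≤ L) :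
    0 ≤ const3131 ϱ B₀ CP c L := by
  have hA := constA_nonneg (L := L) hϱ hB₀ hCP hc
  unfold const3131
  have : 0 ≤ constA ϱ B₀ CP c L * c := mul_nonneg hA hc
  exact mul_nonneg (mul_nonneg (mul_nonneg hc (pow_nonneg (le_trans zero_le_one hL) 5)) hA) (by linarith)

/-- the two monomials of the T-letter constants against `const3131`: `A·c·Lᵐ·t + A²·c²·Lⁿ·t ≦ const3131·t` (m, n ≦ 5, L ≧ 1). [cite: Balaban1985BackgroundPropagators, (3.131) p.422 (bookkeeping)] -/
theorem monomials_le_const3131 {ϱ B₀ CP c L t : ℝ} (hϱ : 0 ≤ ϱ) (hB₀ : 0 ≤ B₀) (hCP : 0 ≤ CP) (hc : 0 ≤ c) (hL : 1 ≤ L) (ht : 0 ≤ t)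
    {m n : ℕ} (hm : m ≤ 5) (hn : n ≤ 5) (u v : ℝ) (hu : u ≤ 1) (hv : v ≤ 1) :
    u * (constA ϱ B₀ CP c L * c * L ^ m * t) + v * (constA ϱ B₀ CP c L ^ 2 * c ^ 2 * L ^ n * t) ≤ const3131 ϱ B₀ CP c L * t := by
  set A := constA ϱ B₀ CP c L with hAdef
  have hA : 0 ≤ A := constA_nonneg (L := L) hϱ hB₀ hCP hc
  have hLm : L ^ m ≤ L ^ 5 := pow_le_pow_right₀ hL hm
  have hLn : L ^ n ≤ L ^ 5 := pow_le_pow_right₀ hL hn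
  have h1 : u * (A * c * L ^ m * t) ≤ A * c * L ^ 5 * t := by
    have h0 : 0 ≤ A * c * L ^ m * t := mul_nonneg (mul_nonneg (mul_nonneg hA hc) (pow_nonneg (le_trans zero_le_one hL) m)) ht
    calc u * (A * c * L ^ m * t) ≤ 1 * (A * c * L ^ m * t) := mul_le_mul_of_nonneg_right hu h0
      _ = A * c * t * L ^ m := by ring
      _ ≤ A * c * t * L ^ 5 := mul_le_mul_of_nonneg_left hLm (mul_nonneg (mul_nonneg hA hc) ht)
      _ = A * c * L ^ 5 * t := by ring
  have h2 : v * (A ^ 2 * c ^ 2 * L ^ n * t) ≤ A ^ 2 * c ^ 2 * L ^ 5 * t := by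
    have h0 : 0 ≤ A ^ 2 * c ^ 2 * L ^ n * t := mul_nonneg (mul_nonneg (mul_nonneg (sq_nonneg A) (sq_nonneg c)) (pow_nonneg (le_trans zero_le_one hL) n)) ht
    calc v * (A ^ 2 * c ^ 2 * L ^ n * t) ≤ 1 * (A ^ 2 * c ^ 2 * L ^ n * t) := mul_le_mul_of_nonneg_right hv h0
      _ = A ^ 2 * c ^ 2 * t * L ^ n := by ring
      _ ≤ A ^ 2 * c ^ 2 * t * L ^ 5 := mul_le_mul_of_nonneg_left hLn (mul_nonneg (mul_nonneg (sq_nonneg A) (sq_nonneg c)) ht)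
      _ = A ^ 2 * c ^ 2 * L ^ 5 * t := by ring
  calc u * (A * c * L ^ m * t) + v * (A ^ 2 * c ^ 2 * L ^ n * t) ≤ A * c * L ^ 5 * t + A ^ 2 * c ^ 2 * L ^ 5 * t := add_le_add h1 h2
    _ = const3131 ϱ B₀ CP c L * t := by rw [const3131, ← hAdef]; ring

section Targets

variable {blkW : XS → g.Site} {blk : XB → g.Site} {Gp P R : Module.End ℝ (XS → ℝ)} {Dv Bop : (XS → ℝ) →ₗ[ℝ] (XB → ℝ)}
  {Dvs Bdop : (XB → ℝ) →ₗ[ℝ] (XS → ℝ)} {B₀ δ₀ CP δP tB δB r δT ϱ σ c : ℝ} {dF : ℕ} {δ α L₀ : ℝ}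

/-- ★★ **THE MAJORANT OF T_a = BG′RD\* = B·𝒫 : 𝔠⁽²⁾ → 𝔠⁽⁰⁾** (the `ta` field of dag-n06-l `B9Thm312WholeStepFrom3131.Letters3131` for the left split letter of
`B9PerturbationSplitAtLetters`): from Theorem 3.1 (3.42)₁₂₃ for G′, (3.49)₁₂₃ for P and the current letter B (order (Lʲη)⁻³·t_B), the composite has the
block majorant `|w|·const3131·t_B·e^{−δ_T d}` (for the word with a scalar weight `w`, as it occurs at the pinned models) between the state norms
`cNorm … 2 → cNorm … 0` for every δ_T ≧ 0 with δ_T + 2σ + 3αδ ≦ r ≦ min(δ₀, δ_P, δ_B) (one composition and two transfers spent; print: t = O(1)·Mα₀).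
[cite: Balaban1985BackgroundPropagators, (3.130)–(3.131) pp.421–422, (3.42) p.397, (3.49) p.399, (3.117) p.419, (3.36) p.396; Balaban1984PropagatorsII, (2.54), (2.60)–(2.61) pp.233–234] -/
theorem maj_taL (hG : GeoOK g) (hF : Facts347 g R₀ H₀ dF δ α L₀) (hrow : RowSum (toB6 g R₀ H₀) σ c)
    (h31 : Thm31GpMaj blkW blk Gp Dv Dvs R₀ H₀ B₀ δ₀) (h49 : Proj349Maj blkW blk P Dv Dvs R₀ H₀ CP δP)
    (hB : CurrentMaj blkW blk Bop Bdop R₀ H₀ tB δB) (hR : R = ϱ • (LinearMap.id - P))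
    (hϱ : 0 ≤ ϱ) (hB₀ : 0 ≤ B₀) (hCP : 0 ≤ CP) (htB : 0 ≤ tB) (hc : 0 ≤ c) (hσ : 0 ≤ σ) (hτ : 0 ≤ α * δ)
    (hr₀ : r ≤ δ₀) (hrP : r ≤ δP) (hrB : r ≤ δB) (hδT₀ : 0 ≤ δT) (hδT : δT + 2 * σ + 3 * (α * δ) ≤ r) (w : ℝ) :
    HasMaj (cNorm R₀ H₀ blk hG.lenle 2) (cNorm R₀ H₀ blk hG.lenle 0) (w • (Bop ∘ₗ Gp ∘ₗ R ∘ₗ Dvs))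
      (fun a b => |w| * (const3131 ϱ B₀ CP c g.L * tB) * Real.exp (-(δT * g.dist a b))) := by
  have hL1 : 1 ≤ g.L := hF.one_le_L
  have hL0 : 0 ≤ g.L := le_trans zero_le_one hL1
  have hA : 0 ≤ constA ϱ B₀ CP c g.L := constA_nonneg hϱ hB₀ hCP hc
  -- 𝒫 = G′RD* : 𝔠^{(0)} → 𝔠_W^{(−1)}
  have hP := maj_GpRDvs hG hF hrow (h31.gp_cls hG hB₀ hr₀) (h31.gpDvs_cls hG hB₀ hr₀) (h49.pDvs_cls hG hCP hrP) hR hϱ hB₀ hCP hc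
    hσ hτ (by linarith)
  have hB1 := hasMaj_shift hG hF (-1 : ℝ) (by norm_num) htB (hB.b_cls hG htB hrB)
  rw [rpow_abs_eq_pow g.L (-1) 1 (by norm_num), pow_one, show (0 : ℝ) + -1 = -1 by norm_num, show (3 : ℝ) + -1 = 2 by norm_num] at hB1
  -- B ∘ 𝒫 : 𝔠^{(0)} → 𝔠^{(2)}, rate r − σ − αδ
  have hBP := hasMaj_comp_cNormR hG hrow (mul_nonneg htB hL0) hA (show 0 ≤ r - σ - α * δ by linarith) le_rfl (by linarith) hB1 hP
  have hsh := hasMaj_shift hG hF (-2 : ℝ) (by norm_num) (mul_nonneg (mul_nonneg (mul_nonneg htB hL0) hA) hc) hBP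
  rw [rpow_abs_eq_pow g.L (-2) 2 (by norm_num), show (0 : ℝ) + -2 = -((2 : ℕ) : ℝ) by norm_num,
    show (2 : ℝ) + -2 = -((0 : ℕ) : ℝ) by norm_num] at hsh
  refine hasMaj_ofR hG (hasMaj_weaken hG (mul_nonneg (abs_nonneg w)
    (mul_nonneg (mul_nonneg (mul_nonneg (mul_nonneg htB hL0) hA) hc) (pow_nonneg hL0 2))) ?_ (by linarith) (hasMaj_smul_exp hsh w))
  have key := monomials_le_const3131 hϱ hB₀ hCP hc hL1 htB (show 3 ≤ 5 by norm_num) (show 0 ≤ 5 by norm_num) 1 0 le_rfl zero_le_one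
  refine mul_le_mul_of_nonneg_left ?_ (abs_nonneg w)
  calc _ = 1 * (constA ϱ B₀ CP c g.L * c * g.L ^ 3 * tB) + 0 * (constA ϱ B₀ CP c g.L ^ 2 * c ^ 2 * g.L ^ 0 * tB) := by ring
    _ ≤ const3131 ϱ B₀ CP c g.L * tB := key

/-- ★★ **THE MAJORANT OF T_b = RG′B† − RG′D\*BG′RD\* = 𝒬B† − 𝒮B𝒫 : 𝔠⁽²⁾ → 𝔠_W⁽¹⁾** (the `tb` field of `Letters3131`; scalar weights `w₁, w₂` on the two words):
block majorant `(|w₁| + |w₂|)·const3131·t_B·e^{−δ_T d}` between `cNorm … blk 2 → cNorm … blkW 1`, δ_T + 2σ + 3αδ ≦ r (two compositions and three transfers in the longest word).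
[cite: Balaban1985BackgroundPropagators, (3.130)–(3.131) pp.421–422, (3.42) p.397, (3.49) p.399, (3.117) p.419, (3.36) p.396; Balaban1984PropagatorsII, (2.54), (2.60)–(2.61) pp.233–234] -/
theorem maj_tbL (hG : GeoOK g) (hF : Facts347 g R₀ H₀ dF δ α L₀) (hrow : RowSum (toB6 g R₀ H₀) σ c)
    (h31 : Thm31GpMaj blkW blk Gp Dv Dvs R₀ H₀ B₀ δ₀) (h49 : Proj349Maj blkW blk P Dv Dvs R₀ H₀ CP δP)
    (hB : CurrentMaj blkW blk Bop Bdop R₀ H₀ tB δB) (hR : R = ϱ • (LinearMap.id - P))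
    (hϱ : 0 ≤ ϱ) (hB₀ : 0 ≤ B₀) (hCP : 0 ≤ CP) (htB : 0 ≤ tB) (hc : 0 ≤ c) (hσ : 0 ≤ σ) (hτ : 0 ≤ α * δ)
    (hr₀ : r ≤ δ₀) (hrP : r ≤ δP) (hrB : r ≤ δB) (hδT₀ : 0 ≤ δT) (hδT : δT + 2 * σ + 3 * (α * δ) ≤ r) (w₁ w₂ : ℝ) :
    HasMaj (cNorm R₀ H₀ blk hG.lenle 2) (cNorm R₀ H₀ blkW hG.lenle 1)
      (w₁ • (R ∘ₗ Gp ∘ₗ Bdop) - w₂ • (R ∘ₗ Gp ∘ₗ Dvs ∘ₗ Bop ∘ₗ Gp ∘ₗ R ∘ₗ Dvs))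
      (fun a b => (|w₁| + |w₂|) * (const3131 ϱ B₀ CP c g.L * tB) * Real.exp (-(δT * g.dist a b))) := by
  have hL1 : 1 ≤ g.L := hF.one_le_L
  have hL0 : 0 ≤ g.L := le_trans zero_le_one hL1
  have hA : 0 ≤ constA ϱ B₀ CP c g.L := constA_nonneg hϱ hB₀ hCP hc
  -- first word 𝒬B†: 𝒬 = RG′ shifted by +3 (𝔠_W^{(3)} → 𝔠_W^{(1)}) after B† : 𝔠^{(0)} → 𝔠_W^{(3)}
  have hQ := maj_RGp hG hF hrow (h31.gp_cls hG hB₀ hr₀) (h49.p_cls hG hCP hrP) hR hϱ hB₀ hCP hc hσ hτ (by linarith)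
  have hQ' := hasMaj_shift hG hF (3 : ℝ) (by norm_num) hA hQ
  rw [rpow_abs_eq_pow g.L 3 3 (by norm_num), show (0 : ℝ) + 3 = 3 by norm_num, show (-2 : ℝ) + 3 = 1 by norm_num] at hQ'
  have t1 := hasMaj_comp_cNormR hG hrow (mul_nonneg hA (pow_nonneg hL0 3)) htB (show 0 ≤ r - 2 * σ - 2 * (α * δ) by linarith)
    (by linarith) (by linarith) hQ' (hB.bd_cls hG htB hrB)
  -- second word 𝒮B𝒫: B𝒫 : 𝔠^{(0)} → 𝔠^{(2)} as in `maj_taL`, then 𝒮 = RG′D* shifted by +2 (𝔠^{(2)} → 𝔠_W^{(1)})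
  have hP := maj_GpRDvs hG hF hrow (h31.gp_cls hG hB₀ hr₀) (h31.gpDvs_cls hG hB₀ hr₀) (h49.pDvs_cls hG hCP hrP) hR hϱ hB₀ hCP hc
    hσ hτ (by linarith)
  have hB1 := hasMaj_shift hG hF (-1 : ℝ) (by norm_num) htB (hB.b_cls hG htB hrB)
  rw [rpow_abs_eq_pow g.L (-1) 1 (by norm_num), pow_one, show (0 : ℝ) + -1 = -1 by norm_num, show (3 : ℝ) + -1 = 2 by norm_num] at hB1
  have hBP := hasMaj_comp_cNormR hG hrow (mul_nonneg htB hL0) hA (show 0 ≤ r - σ - α * δ by linarith) le_rfl (by linarith) hB1 hP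
  have hS := maj_RGpDvs hG hF hrow (h31.gpDvs_cls hG hB₀ hr₀) (h49.p_cls hG hCP hrP) hR hϱ hB₀ hCP hc hσ hτ (by linarith)
  have hS' := hasMaj_shift hG hF (2 : ℝ) (by norm_num) hA hS
  rw [rpow_abs_eq_pow g.L 2 2 (by norm_num), show (0 : ℝ) + 2 = 2 by norm_num, show (-1 : ℝ) + 2 = 1 by norm_num] at hS'
  have t2 := hasMaj_comp_cNormR hG hrow (mul_nonneg hA (pow_nonneg hL0 2)) (mul_nonneg (mul_nonneg (mul_nonneg htB hL0) hA) hc)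
    (show 0 ≤ r - 2 * σ - 2 * (α * δ) by linarith) (by linarith) (by linarith) hS' hBP
  have n1 : 0 ≤ constA ϱ B₀ CP c g.L * g.L ^ 3 * tB * c := mul_nonneg (mul_nonneg (mul_nonneg hA (pow_nonneg hL0 3)) htB) hc
  have n2 : 0 ≤ constA ϱ B₀ CP c g.L * g.L ^ 2 * (tB * g.L * constA ϱ B₀ CP c g.L * c) * c :=
    mul_nonneg (mul_nonneg (mul_nonneg hA (pow_nonneg hL0 2)) (mul_nonneg (mul_nonneg (mul_nonneg htB hL0) hA) hc)) hc
  have hsh := hasMaj_shift hG hF (-2 : ℝ) (by norm_num) ?_ (hasMaj_sub_exp (hasMaj_smul_exp t1 w₁) (hasMaj_smul_exp t2 w₂))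
  swap
  · exact add_nonneg (mul_nonneg (abs_nonneg _) n1) (mul_nonneg (abs_nonneg _) n2)
  rw [rpow_abs_eq_pow g.L (-2) 2 (by norm_num), show (0 : ℝ) + -2 = -((2 : ℕ) : ℝ) by norm_num,
    show (1 : ℝ) + -2 = -((1 : ℕ) : ℝ) by norm_num] at hsh
  refine (hasMaj_ofR hG (hasMaj_weaken hG ?_ ?_ (by linarith) hsh)).congr fun μ => rfl
  · exact mul_nonneg (add_nonneg (mul_nonneg (abs_nonneg _) n1) (mul_nonneg (abs_nonneg _) n2)) (pow_nonneg hL0 2)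
  · have k1 := monomials_le_const3131 hϱ hB₀ hCP hc hL1 htB (show 5 ≤ 5 by norm_num) (show 0 ≤ 5 by norm_num) 1 0 le_rfl zero_le_one
    have k2 := monomials_le_const3131 hϱ hB₀ hCP hc hL1 htB (show 0 ≤ 5 by norm_num) (show 5 ≤ 5 by norm_num) 0 1 zero_le_one le_rfl
    calc _ = |w₁| * (1 * (constA ϱ B₀ CP c g.L * c * g.L ^ 5 * tB) + 0 * (constA ϱ B₀ CP c g.L ^ 2 * c ^ 2 * g.L ^ 0 * tB)) +
          |w₂| * (0 * (constA ϱ B₀ CP c g.L * c * g.L ^ 0 * tB) + 1 * (constA ϱ B₀ CP c g.L ^ 2 * c ^ 2 * g.L ^ 5 * tB)) := by ring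
      _ ≤ |w₁| * (const3131 ϱ B₀ CP c g.L * tB) + |w₂| * (const3131 ϱ B₀ CP c g.L * tB) :=
          add_le_add (mul_le_mul_of_nonneg_left k1 (abs_nonneg _)) (mul_le_mul_of_nonneg_left k2 (abs_nonneg _))
      _ = (|w₁| + |w₂|) * (const3131 ϱ B₀ CP c g.L * tB) := by ring

/-- ★★ **THE MAJORANT OF T_a′ = DRG′B† = 𝒫†B† : 𝔠⁽²⁾ → 𝔠⁽⁰⁾** (the `ta` field of dag-n06-l `B9Thm312WholeRightStepFrom3131.Letters3131R`; weight `w`): block majorant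
`|w|·const3131·t_B·e^{−δ_T d}` between `cNorm … blk 2 → cNorm … blk 0`, δ_T + 2σ + 3αδ ≦ r.
[cite: Balaban1985BackgroundPropagators, (3.130)–(3.131) pp.421–422, (3.42) p.397, (3.49) p.399, (3.117) p.419; Balaban1984PropagatorsII, (2.26) p.228, (2.54), (2.60)–(2.61) pp.233–234] -/
theorem maj_taR (hG : GeoOK g) (hF : Facts347 g R₀ H₀ dF δ α L₀) (hrow : RowSum (toB6 g R₀ H₀) σ c)
    (h31 : Thm31GpMaj blkW blk Gp Dv Dvs R₀ H₀ B₀ δ₀) (h49 : Proj349Maj blkW blk P Dv Dvs R₀ H₀ CP δP)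
    (hB : CurrentMaj blkW blk Bop Bdop R₀ H₀ tB δB) (hR : R = ϱ • (LinearMap.id - P))
    (hϱ : 0 ≤ ϱ) (hB₀ : 0 ≤ B₀) (hCP : 0 ≤ CP) (htB : 0 ≤ tB) (hc : 0 ≤ c) (hσ : 0 ≤ σ) (hτ : 0 ≤ α * δ)
    (hr₀ : r ≤ δ₀) (hrP : r ≤ δP) (hrB : r ≤ δB) (hδT₀ : 0 ≤ δT) (hδT : δT + 2 * σ + 3 * (α * δ) ≤ r) (w : ℝ) :
    HasMaj (cNorm R₀ H₀ blk hG.lenle 2) (cNorm R₀ H₀ blk hG.lenle 0) (w • (Dv ∘ₗ R ∘ₗ Gp ∘ₗ Bdop))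
      (fun a b => |w| * (const3131 ϱ B₀ CP c g.L * tB) * Real.exp (-(δT * g.dist a b))) := by
  have hL1 : 1 ≤ g.L := hF.one_le_L
  have hL0 : 0 ≤ g.L := le_trans zero_le_one hL1
  have hA : 0 ≤ constA ϱ B₀ CP c g.L := constA_nonneg hϱ hB₀ hCP hc
  -- 𝒫† = DRG′ shifted by +3 (𝔠_W^{(3)} → 𝔠^{(2)}) after B† : 𝔠^{(0)} → 𝔠_W^{(3)}
  have hPd := maj_DvRGp hG hF hrow (h31.gp_cls hG hB₀ hr₀) (h31.dvGp_cls hG hB₀ hr₀) (h49.dvP_cls hG hCP hrP) hR hϱ hB₀ hCP hc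
    hσ hτ (by linarith)
  have hPd' := hasMaj_shift hG hF (3 : ℝ) (by norm_num) hA hPd
  rw [rpow_abs_eq_pow g.L 3 3 (by norm_num), show (0 : ℝ) + 3 = 3 by norm_num, show (-1 : ℝ) + 3 = 2 by norm_num] at hPd'
  have hcomp := hasMaj_comp_cNormR hG hrow (mul_nonneg hA (pow_nonneg hL0 3)) htB (show 0 ≤ r - 2 * σ - 2 * (α * δ) by linarith)
    (by linarith) (by linarith) hPd' (hB.bd_cls hG htB hrB)
  have hsh := hasMaj_shift hG hF (-2 : ℝ) (by norm_num) (mul_nonneg (mul_nonneg (mul_nonneg hA (pow_nonneg hL0 3)) htB) hc) hcomp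
  rw [rpow_abs_eq_pow g.L (-2) 2 (by norm_num), show (0 : ℝ) + -2 = -((2 : ℕ) : ℝ) by norm_num,
    show (2 : ℝ) + -2 = -((0 : ℕ) : ℝ) by norm_num] at hsh
  refine (hasMaj_ofR hG (hasMaj_weaken hG ?_ ?_ (by linarith) (hasMaj_smul_exp hsh w))).congr fun μ => rfl
  · exact mul_nonneg (abs_nonneg w) (mul_nonneg (mul_nonneg (mul_nonneg (mul_nonneg hA (pow_nonneg hL0 3)) htB) hc) (pow_nonneg hL0 2))
  · have key := monomials_le_const3131 hϱ hB₀ hCP hc hL1 htB (show 5 ≤ 5 by norm_num) (show 0 ≤ 5 by norm_num) 1 0 le_rfl zero_le_one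
    refine mul_le_mul_of_nonneg_left ?_ (abs_nonneg w)
    calc _ = 1 * (constA ϱ B₀ CP c g.L * c * g.L ^ 5 * tB) + 0 * (constA ϱ B₀ CP c g.L ^ 2 * c ^ 2 * g.L ^ 0 * tB) := by ring
      _ ≤ const3131 ϱ B₀ CP c g.L * tB := key

/-- ★★ **THE MAJORANT OF T_b′ = BG′R − DRG′D\*BG′R = B𝒬† − 𝒫†B†𝒮† : 𝔠_W^{(0)} → 𝔠^{(1)}** (the `tb` field of `Letters3131R`, real-weight classes
`cNormR … blkW 0 → cNormR … blk 1`; weights `w₁, w₂`): block majorant `(|w₁| + |w₂|)·const3131·t_B·e^{−δ_T d}`, δ_T + 2σ + 3αδ ≦ r.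
[cite: Balaban1985BackgroundPropagators, (3.130)–(3.131) pp.421–422, (3.42) p.397, (3.49) p.399, (3.117) p.419; Balaban1984PropagatorsII, (2.26) p.228, (2.54), (2.60)–(2.61) pp.233–234] -/
theorem maj_tbR (hG : GeoOK g) (hF : Facts347 g R₀ H₀ dF δ α L₀) (hrow : RowSum (toB6 g R₀ H₀) σ c)
    (h31 : Thm31GpMaj blkW blk Gp Dv Dvs R₀ H₀ B₀ δ₀) (h49 : Proj349Maj blkW blk P Dv Dvs R₀ H₀ CP δP)
    (hB : CurrentMaj blkW blk Bop Bdop R₀ H₀ tB δB) (hR : R = ϱ • (LinearMap.id - P))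
    (hϱ : 0 ≤ ϱ) (hB₀ : 0 ≤ B₀) (hCP : 0 ≤ CP) (htB : 0 ≤ tB) (hc : 0 ≤ c) (hσ : 0 ≤ σ) (hτ : 0 ≤ α * δ)
    (hr₀ : r ≤ δ₀) (hrP : r ≤ δP) (hrB : r ≤ δB) (hδT₀ : 0 ≤ δT) (hδT : δT + 2 * σ + 3 * (α * δ) ≤ r) (w₁ w₂ : ℝ) :
    HasMaj (cNormR R₀ H₀ blkW hG.lenle 0) (cNormR R₀ H₀ blk hG.lenle 1)
      (w₁ • (Bop ∘ₗ Gp ∘ₗ R) - w₂ • (Dv ∘ₗ R ∘ₗ Gp ∘ₗ Bdop ∘ₗ Dv ∘ₗ Gp ∘ₗ R))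
      (fun a b => (|w₁| + |w₂|) * (const3131 ϱ B₀ CP c g.L * tB) * Real.exp (-(δT * g.dist a b))) := by
  have hL1 : 1 ≤ g.L := hF.one_le_L
  have hL0 : 0 ≤ g.L := le_trans zero_le_one hL1
  have hA : 0 ≤ constA ϱ B₀ CP c g.L := constA_nonneg hϱ hB₀ hCP hc
  -- first word B𝒬†: B shifted by −2 (𝔠_W^{(−2)} → 𝔠^{(1)}) after 𝒬† = G′R : 𝔠_W^{(0)} → 𝔠_W^{(−2)}
  have hQd := maj_GpR hG hF hrow (h31.gp_cls hG hB₀ hr₀) (h49.p_cls hG hCP hrP) hR hϱ hB₀ hCP hc hσ hτ (by linarith)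
  have hB2 := hasMaj_shift hG hF (-2 : ℝ) (by norm_num) htB (hB.b_cls hG htB hrB)
  rw [rpow_abs_eq_pow g.L (-2) 2 (by norm_num), show (0 : ℝ) + -2 = -2 by norm_num, show (3 : ℝ) + -2 = 1 by norm_num] at hB2
  have t1 := hasMaj_comp_cNormR hG hrow (mul_nonneg htB (pow_nonneg hL0 2)) hA (show 0 ≤ r - 2 * σ - 2 * (α * δ) by linarith)
    (by linarith) (by linarith) hB2 hQd
  -- second word 𝒫†B†𝒮†: 𝒮† = DG′R : 𝔠_W^{(0)} → 𝔠^{(−1)}, B† shifted by −1 (𝔠^{(−1)} → 𝔠_W^{(2)}), 𝒫† shifted by +2 (𝔠_W^{(2)} → 𝔠^{(1)})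
  have hSd := maj_DvGpR hG hF hrow (h31.dvGp_cls hG hB₀ hr₀) (h49.p_cls hG hCP hrP) hR hϱ hB₀ hCP hc hσ hτ (by linarith)
  have hBd1 := hasMaj_shift hG hF (-1 : ℝ) (by norm_num) htB (hB.bd_cls hG htB hrB)
  rw [rpow_abs_eq_pow g.L (-1) 1 (by norm_num), pow_one, show (0 : ℝ) + -1 = -1 by norm_num, show (3 : ℝ) + -1 = 2 by norm_num] at hBd1
  have u := hasMaj_comp_cNormR hG hrow (mul_nonneg htB hL0) hA (show 0 ≤ r - σ - α * δ by linarith) le_rfl (by linarith) hBd1 hSd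
  have hPd := maj_DvRGp hG hF hrow (h31.gp_cls hG hB₀ hr₀) (h31.dvGp_cls hG hB₀ hr₀) (h49.dvP_cls hG hCP hrP) hR hϱ hB₀ hCP hc
    hσ hτ (by linarith)
  have hPd' := hasMaj_shift hG hF (2 : ℝ) (by norm_num) hA hPd
  rw [rpow_abs_eq_pow g.L 2 2 (by norm_num), show (0 : ℝ) + 2 = 2 by norm_num, show (-1 : ℝ) + 2 = 1 by norm_num] at hPd'
  have t2 := hasMaj_comp_cNormR hG hrow (mul_nonneg hA (pow_nonneg hL0 2)) (mul_nonneg (mul_nonneg (mul_nonneg htB hL0) hA) hc)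
    (show 0 ≤ r - 2 * σ - 2 * (α * δ) by linarith) (by linarith) (by linarith) hPd' u
  have n1 : 0 ≤ tB * g.L ^ 2 * constA ϱ B₀ CP c g.L * c := mul_nonneg (mul_nonneg (mul_nonneg htB (pow_nonneg hL0 2)) hA) hc
  have n2 : 0 ≤ constA ϱ B₀ CP c g.L * g.L ^ 2 * (tB * g.L * constA ϱ B₀ CP c g.L * c) * c :=
    mul_nonneg (mul_nonneg (mul_nonneg hA (pow_nonneg hL0 2)) (mul_nonneg (mul_nonneg (mul_nonneg htB hL0) hA) hc)) hc
  refine (hasMaj_weaken hG ?_ ?_ (by linarith) (hasMaj_sub_exp (hasMaj_smul_exp t1 w₁) (hasMaj_smul_exp t2 w₂))).congr fun μ => rfl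
  · exact add_nonneg (mul_nonneg (abs_nonneg _) n1) (mul_nonneg (abs_nonneg _) n2)
  · have k1 := monomials_le_const3131 hϱ hB₀ hCP hc hL1 htB (show 2 ≤ 5 by norm_num) (show 0 ≤ 5 by norm_num) 1 0 le_rfl zero_le_one
    have k2 := monomials_le_const3131 hϱ hB₀ hCP hc hL1 htB (show 0 ≤ 5 by norm_num) (show 3 ≤ 5 by norm_num) 0 1 zero_le_one le_rfl
    calc _ = |w₁| * (1 * (constA ϱ B₀ CP c g.L * c * g.L ^ 2 * tB) + 0 * (constA ϱ B₀ CP c g.L ^ 2 * c ^ 2 * g.L ^ 0 * tB)) +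
          |w₂| * (0 * (constA ϱ B₀ CP c g.L * c * g.L ^ 0 * tB) + 1 * (constA ϱ B₀ CP c g.L ^ 2 * c ^ 2 * g.L ^ 3 * tB)) := by ring
      _ ≤ |w₁| * (const3131 ϱ B₀ CP c g.L * tB) + |w₂| * (const3131 ϱ B₀ CP c g.L * tB) :=
          add_le_add (mul_le_mul_of_nonneg_left k1 (abs_nonneg _)) (mul_le_mul_of_nonneg_left k2 (abs_nonneg _))
      _ = (|w₁| + |w₂|) * (const3131 ϱ B₀ CP c g.L * tB) := by ring

end Targets

end

end Literature.MathematicalPhysics.QuantumFieldTheory.Balaban1983to89.B9PerturbationMajorantLetters
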